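import Mathlib.Analysis.Convex.Contractible
import Mathlib.Analysis.Normed.Module.Connected
import Mathlib.LinearAlgebra.Basis.VectorSpace
import Mathlib.Analysis.InnerProductSpace.PiL2
import Mathlib.LinearAlgebra.Complex.FiniteDimensional
import Literature.AlgebraicTopology.CharacteristicClasses.ProjectiveDeformation
import HarnessLib

/-!
# The cover of `ℙ(V)` by an affine chart and the complement of its centre

Topic `Literature/AlgebraicTopology/CharacteristicClasses`. The point-set geometry behind the
cell structure `ℂPⁿ = ℂPⁿ⁻¹ ∪ e²ⁿ` (A. Hatcher, *Algebraic Topology* (2002), Ch. 0 p. 7 and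
Example 0.6), for a finite-dimensional complex normed space `V` with a functional `ψ` and a vector
`u` with `ψ u = 1` (so `V = W ⊕ ℂu`, `W = ker ψ`):

* `hyperplaneProj ψ u = 1 - u ⊗ ψ`, the projection onto `W` along `u` (`P² = P`, `range P = W`,
  `finrank (range P) + 1 = finrank V`), so that `projChart P = ℙ V ∖ {[u]}` retracts onto
  `rangeLocus P ≅ ℙ(W)` (`ProjectiveDeformation`);
* the affine chart `U = chartDomain ψ = {[v] | ψ v ≠ 0}` is homeomorphic to the affine hyperplane
  `{ψ = 1}` (`affineChartHomeomorph`, through `affineRep`), hence CONTRACTIBLE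
  (`contractibleSpace_chartDomain`) — the open `2n`-cell;
* `U ∪ projChart P = ℙ V` (`chartDomain_union_projChart`), an open cover;
* the overlap `U ∩ projChart P` (the cell minus its centre `[u]`) is homeomorphic to `W ∖ {0}`
  (`puncturedChartHomeomorph`, `[v] ↦ v/ψ(v) - u`), a punctured complex space of dimension
  `n - 1`, hence to `ℝ²ⁿ⁻² ∖ {0}` (`puncturedKerHomeomorphEuclidean`): path connected and, in
  homology, a sphere `S²ⁿ⁻³` (used in `ProjectiveSpaceLowHomology`);
* `exists_hyperplane`: when `finrank V ≥ 3`, two given vectors lie in a common hyperplane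
  `ker ψ` with a complementary `u`, `ψ u = 1`.

Everything is proved; no named facts.

## References

* A. Hatcher, *Algebraic Topology*, CUP 2002, Ch. 0 p. 7, Example 0.6 (cells of `ℂPⁿ`).
  [Hatcher2002]
* F. Hirzebruch, *Topological Methods in Algebraic Geometry* (1966), §4.2 (affine charts `Uᵢ`).
  [Hirzebruch1966]
-/

noncomputable section

open Function Set Filter Topology Module
open scoped LinearAlgebra.Projectivization

universe u

namespace Literature.AlgebraicTopology.CharacteristicClasses

variable {V : Type u} [NormedAddCommGroup V] [NormedSpace ℂ V]

/-! ### Two vectors lie in a common hyperplane -/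

/-- In dimension `≥ 3` two vectors lie in a common hyperplane `ker ψ` admitting a complementary
vector `u` with `ψ u = 1`. [folklore] -/
theorem exists_hyperplane [FiniteDimensional ℂ V] (hV : 3 ≤ finrank ℂ V) (e₀ e₁ : V) :
    ∃ (ψ : StrongDual ℂ V) (u : V), ψ e₀ = 0 ∧ ψ e₁ = 0 ∧ ψ u = 1 := by
  classical
  set S : Submodule ℂ V := Submodule.span ℂ (({e₀, e₁} : Finset V) : Set V) with hS
  have hSlt : S < ⊤ := by
    refine lt_top_iff_ne_top.2 fun h ↦ ?_
    have h2 : finrank ℂ S ≤ 2 :=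
      (finrank_span_finset_le_card ({e₀, e₁} : Finset V)).trans (Finset.card_le_two)
    rw [h, finrank_top] at h2
    omega
  obtain ⟨f, hf0, hSf⟩ := Submodule.exists_le_ker_of_lt_top S hSlt
  obtain ⟨w, hw⟩ : ∃ w, f w ≠ 0 := by
    by_contra h
    push Not at h
    exact hf0 (LinearMap.ext h)
  have he₀ : f e₀ = 0 := LinearMap.mem_ker.1 (hSf (Submodule.subset_span (by simp)))
  have he₁ : f e₁ = 0 := LinearMap.mem_ker.1 (hSf (Submodule.subset_span (by simp)))
  refine ⟨LinearMap.toContinuousLinearMap f, (f w)⁻¹ • w, he₀, he₁, ?_⟩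
  change f ((f w)⁻¹ • w) = 1
  rw [map_smul, smul_eq_mul, inv_mul_cancel₀ hw]

/-! ### The projection onto a hyperplane along a complementary vector -/

section Hyperplane

variable (ψ : StrongDual ℂ V) (u : V)

/-- The projection `P = 1 - u ⊗ ψ`, `P v = v - ψ(v) u`, onto the hyperplane `ker ψ` along `u`
(for `ψ u = 1`). [folklore] -/
def hyperplaneProj : V →L[ℂ] V := ContinuousLinearMap.id ℂ V - ψ.smulRight u

/-- `P v = v - ψ(v) u`. [folklore] -/
@[simp]
theorem hyperplaneProj_apply (v : V) : hyperplaneProj ψ u v = v - ψ v • u := rfl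

variable {ψ u}

/-- `ψ ∘ P = 0`. [folklore] -/
theorem apply_hyperplaneProj (hu : ψ u = 1) (v : V) : ψ (hyperplaneProj ψ u v) = 0 := by
  rw [hyperplaneProj_apply, map_sub, map_smul, hu, smul_eq_mul, mul_one, sub_self]

/-- `P` is a projection: `P² = P`. [folklore] -/
theorem hyperplaneProj_idem (hu : ψ u = 1) (v : V) : hyperplaneProj ψ u (hyperplaneProj ψ u v) = hyperplaneProj ψ u v := by
  conv_lhs => rw [hyperplaneProj_apply, apply_hyperplaneProj hu, zero_smul, sub_zero]

/-- `P u = 0`. [folklore] -/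
theorem hyperplaneProj_self (hu : ψ u = 1) : hyperplaneProj ψ u u = 0 := by
  rw [hyperplaneProj_apply, hu, one_smul, sub_self]

/-- `P v = v ↔ ψ v = 0` (for `u ≠ 0`). [folklore] -/
theorem hyperplaneProj_eq_self_iff (hu0 : u ≠ 0) (v : V) : hyperplaneProj ψ u v = v ↔ ψ v = 0 := by
  rw [hyperplaneProj_apply, sub_eq_self, smul_eq_zero, or_iff_left hu0]

/-- `u ≠ 0`. [folklore] -/
theorem ne_zero_of_apply_eq_one (hu : ψ u = 1) : u ≠ 0 := fun h ↦ by simp [h] at hu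

/-- The kernel of `P` is the line `ℂ u`. [folklore] -/
theorem ker_hyperplaneProj (hu : ψ u = 1) : LinearMap.ker (hyperplaneProj ψ u : V →ₗ[ℂ] V) = Submodule.span ℂ {u} := by
  ext v
  rw [LinearMap.mem_ker, Submodule.mem_span_singleton]
  change hyperplaneProj ψ u v = 0 ↔ _
  rw [hyperplaneProj_apply, sub_eq_zero]
  constructor
  · exact fun h ↦ ⟨ψ v, h.symm⟩
  · rintro ⟨a, rfl⟩
    rw [map_smul, hu, smul_eq_mul, mul_one]

/-- **Rank of the hyperplane**: `finrank (range P) + 1 = finrank V`. [folklore] -/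
theorem finrank_range_hyperplaneProj [FiniteDimensional ℂ V] (hu : ψ u = 1) :
    finrank ℂ ↥(LinearMap.range (hyperplaneProj ψ u : V →ₗ[ℂ] V)) + 1 = finrank ℂ V := by
  have h := LinearMap.finrank_range_add_finrank_ker (hyperplaneProj ψ u : V →ₗ[ℂ] V)
  rwa [ker_hyperplaneProj hu, finrank_span_singleton (ne_zero_of_apply_eq_one hu)] at h

/-- `[u] ∉ projChart P`, and it is the only such point: `[v] ∈ projChart P ↔ v ∉ ℂu`; in
particular every `[v]` with `ψ v = 0` lies in `projChart P`. [folklore] -/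
theorem mk_mem_projChart_hyperplaneProj_of_apply_eq_zero (hu : ψ u = 1) {v : V} (hv : v ≠ 0)
    (hψ : ψ v = 0) :
    Projectivization.mk ℂ v hv ∈ projChart (hyperplaneProj ψ u) := by
  rw [mk_mem_projChart_iff, (hyperplaneProj_eq_self_iff (ne_zero_of_apply_eq_one hu) v).2 hψ]
  exact hv

/-- **The affine chart and the complement of its centre cover `ℙ V`.** [cite: Hatcher2002, Ch. 0 p. 7] -/
theorem chartDomain_union_projChart (hu : ψ u = 1) :
    chartDomain (ψ : Module.Dual ℂ V) ∪ projChart (hyperplaneProj ψ u) = univ := by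
  refine eq_univ_of_forall fun p ↦ ?_
  induction p with
  | h v hv =>
    by_cases h : ψ v = 0
    · exact Or.inr (mk_mem_projChart_hyperplaneProj_of_apply_eq_zero hu hv h)
    · exact Or.inl ((mk_mem_chartDomain_iff _ v hv).2 h)

/-- The cover is an open cover (interiors cover). [cite: Hatcher2002, Ch. 0 p. 7] -/
theorem interior_chartDomain_union_interior_projChart (hu : ψ u = 1) :
    interior (chartDomain (ψ : Module.Dual ℂ V)) ∪ interior (projChart (hyperplaneProj ψ u)) =
      univ := by
  rw [(isOpen_chartDomain _ ψ.continuous).interior_eq, (isOpen_projChart _).interior_eq,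
    chartDomain_union_projChart hu]

/-! ### The affine chart is an affine hyperplane, hence contractible -/

variable (ψ) in
/-- Points of the level set `{ψ = 1}` are non-zero. [folklore] -/
theorem levelSet_ne_zero {a : V} (ha : a ∈ {v : V | ψ v = 1}) : a ≠ 0 := fun h ↦ by
  have h1 : ψ a = 1 := ha
  rw [h, map_zero] at h1
  exact zero_ne_one h1

variable (ψ) in
/-- On the level set `{ψ = 1}` the functional does not vanish. [folklore] -/
theorem levelSet_apply_ne_zero {a : V} (ha : a ∈ {v : V | ψ v = 1}) : (ψ : Module.Dual ℂ V) a ≠ 0 := by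
  rw [ContinuousLinearMap.coe_coe, show ψ a = 1 from ha]
  exact one_ne_zero

variable (ψ) in
/-- **The affine chart `U_ψ = {[v] | ψ v ≠ 0}` is homeomorphic to the affine hyperplane
`{ψ = 1}`**, by the normalised representative `[v] ↦ v/ψ(v)` with inverse `a ↦ [a]`
(Hirzebruch §4.2: affine coordinates on `Uᵢ`). [cite: Hirzebruch1966, §4.2] -/
def affineChartHomeomorph :
    ↥(chartDomain (ψ : Module.Dual ℂ V)) ≃ₜ ↥{v : V | ψ v = 1} where
  toFun p := ⟨affineRep (ψ : Module.Dual ℂ V) p.1, apply_affineRep (ψ : Module.Dual ℂ V) p.2⟩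
  invFun a := ⟨Projectivization.mk ℂ a.1 (levelSet_ne_zero ψ a.2),
    (mk_mem_chartDomain_iff _ _ _).2 (levelSet_apply_ne_zero ψ a.2)⟩
  left_inv p := Subtype.ext (mk_affineRep _ p.2)
  right_inv a := Subtype.ext (by
    change affineRep (ψ : Module.Dual ℂ V) (Projectivization.mk ℂ a.1 _) = a.1
    rw [affineRep_mk, ContinuousLinearMap.coe_coe, show ψ a.1 = 1 from a.2, inv_one, one_smul])
  continuous_toFun := ((continuousOn_affineRep _ ψ.continuous).restrict).subtype_mk _
  continuous_invFun := (continuous_subtype_val.projectivizationMk _).subtype_mk _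

variable (ψ) in
/-- The affine hyperplane `{ψ = 1}` is convex. [folklore] -/
theorem convex_levelSet : Convex ℝ {v : V | ψ v = 1} := by
  have : {v : V | ψ v = 1} = (ψ.restrictScalars ℝ : V →ₗ[ℝ] ℂ) ⁻¹' {(1 : ℂ)} := rfl
  rw [this]
  exact (convex_singleton (1 : ℂ)).linear_preimage _

/-- **The affine chart is contractible** (it is an affine hyperplane, a convex set containing `u`):
the open `2n`-cell of `ℂPⁿ`. [cite: Hatcher2002, Ch. 0 p. 7] -/
theorem contractibleSpace_chartDomain (hu : ψ u = 1) :
    ContractibleSpace ↥(chartDomain (ψ : Module.Dual ℂ V)) :=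
  haveI : ContractibleSpace ↥{v : V | ψ v = 1} := (convex_levelSet ψ).contractibleSpace ⟨u, hu⟩
  (affineChartHomeomorph ψ).contractibleSpace

/-! ### The punctured chart is a punctured hyperplane -/

variable (u) in
/-- On the affine hyperplane `{ψ = 1}`, `P v = v - u`; so `[v] ∈ U_ψ` lies in `projChart P` iff
its normalised representative differs from `u`. [folklore] -/
theorem mem_projChart_iff_affineRep_ne {p : ℙ ℂ V} (hp : p ∈ chartDomain (ψ : Module.Dual ℂ V)) :
    p ∈ projChart (hyperplaneProj ψ u) ↔ affineRep (ψ : Module.Dual ℂ V) p - u ≠ 0 := by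
  have h1 : ψ (affineRep (ψ : Module.Dual ℂ V) p) = 1 := by
    have := apply_affineRep (ψ : Module.Dual ℂ V) hp
    rwa [ContinuousLinearMap.coe_coe] at this
  conv_lhs => rw [← mk_affineRep _ hp, mk_mem_projChart_iff, hyperplaneProj_apply, h1, one_smul]

/-- The chart coordinate `v/ψ(v) - u` of a point of `U_ψ` lies in `ker ψ`. [folklore] -/
theorem affineRep_sub_mem_ker (hu : ψ u = 1) {p : ℙ ℂ V} (hp : p ∈ chartDomain (ψ : Module.Dual ℂ V)) :
    affineRep (ψ : Module.Dual ℂ V) p - u ∈ LinearMap.ker (ψ : V →ₗ[ℂ] ℂ) := by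
  have h1 := apply_affineRep (ψ : Module.Dual ℂ V) hp
  rw [ContinuousLinearMap.coe_coe] at h1
  rw [LinearMap.mem_ker, ContinuousLinearMap.coe_coe, map_sub, hu, h1, sub_self]

/-- For `w ∈ ker ψ`, `ψ (w + u) = 1`. [folklore] -/
theorem apply_add_eq_one (hu : ψ u = 1) (w : ↥(LinearMap.ker (ψ : V →ₗ[ℂ] ℂ))) : ψ ((w : V) + u) = 1 := by
  rw [map_add, show ψ (w : V) = 0 from w.2, hu, zero_add]

/-- For `w ∈ ker ψ`, `w + u ≠ 0`. [folklore] -/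
theorem add_ne_zero (hu : ψ u = 1) (w : ↥(LinearMap.ker (ψ : V →ₗ[ℂ] ℂ))) : (w : V) + u ≠ 0 := fun h ↦ by
  have := apply_add_eq_one hu w
  rw [h, map_zero] at this
  exact zero_ne_one this

/-- For `w ∈ ker ψ`, `[w + u] ∈ U_ψ`. [folklore] -/
theorem mk_add_mem_chartDomain (hu : ψ u = 1) (w : ↥(LinearMap.ker (ψ : V →ₗ[ℂ] ℂ))) :
    Projectivization.mk ℂ ((w : V) + u) (add_ne_zero hu w) ∈ chartDomain (ψ : Module.Dual ℂ V) :=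
  (mk_mem_chartDomain_iff _ _ _).2 (by
    rw [ContinuousLinearMap.coe_coe, apply_add_eq_one hu w]
    exact one_ne_zero)

/-- For `w ∈ ker ψ`, `w ≠ 0`, `[w + u] ∈ projChart P` (`P (w + u) = w`). [folklore] -/
theorem mk_add_mem_projChart (hu : ψ u = 1) (w : ↥(({0}ᶜ : Set ↥(LinearMap.ker (ψ : V →ₗ[ℂ] ℂ))))) :
    Projectivization.mk ℂ ((w.1 : V) + u) (add_ne_zero hu w.1) ∈ projChart (hyperplaneProj ψ u) := by
  rw [mk_mem_projChart_iff, hyperplaneProj_apply, apply_add_eq_one hu w.1, one_smul,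
    add_sub_cancel_right]
  exact fun h ↦ w.2 (Subtype.ext h)

/-- **The punctured affine chart `U_ψ ∖ {[u]} = U_ψ ∩ projChart P` is homeomorphic to the
punctured hyperplane `ker ψ ∖ {0}`**, by `[v] ↦ v/ψ(v) - u` with inverse `w ↦ [w + u]` (the open
cell of `ℂPⁿ` minus its centre; Hatcher 2002, Ch. 0 p. 7 / Example 0.6). [cite: Hatcher2002, Ch. 0 p. 7] -/
def puncturedChartHomeomorph (hu : ψ u = 1) :
    ↥(chartDomain (ψ : Module.Dual ℂ V) ∩ projChart (hyperplaneProj ψ u)) ≃ₜ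
      ↥(({0}ᶜ : Set ↥(LinearMap.ker (ψ : V →ₗ[ℂ] ℂ)))) where
  toFun p := ⟨⟨affineRep (ψ : Module.Dual ℂ V) p.1 - u, affineRep_sub_mem_ker hu p.2.1⟩,
    fun h ↦ (mem_projChart_iff_affineRep_ne u p.2.1).1 p.2.2 (congrArg Subtype.val h)⟩
  invFun w := ⟨Projectivization.mk ℂ ((w.1 : V) + u) (add_ne_zero hu w.1),
    ⟨mk_add_mem_chartDomain hu w.1, mk_add_mem_projChart hu w⟩⟩
  left_inv p := by
    apply Subtype.ext
    change Projectivization.mk ℂ (affineRep (ψ : Module.Dual ℂ V) p.1 - u + u) _ = p.1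
    simp_rw [sub_add_cancel]
    exact mk_affineRep _ p.2.1
  right_inv w := by
    apply Subtype.ext
    apply Subtype.ext
    change affineRep (ψ : Module.Dual ℂ V) (Projectivization.mk ℂ ((w.1 : V) + u) _) - u = w.1
    rw [affineRep_mk, ContinuousLinearMap.coe_coe, apply_add_eq_one hu w.1, inv_one, one_smul,
      add_sub_cancel_right]
  continuous_toFun :=
    ((((continuousOn_affineRep _ ψ.continuous).comp_continuous continuous_subtype_val
      fun p ↦ p.2.1).sub continuous_const).subtype_mk _).subtype_mk _
  continuous_invFun :=
    (((continuous_subtype_val.comp continuous_subtype_val).add continuous_const).projectivizationMk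
      _).subtype_mk _

/-- **The real dimension of the hyperplane**: `finrank_ℝ (ker ψ) = 2 (finrank_ℂ V - 1)`. [folklore] -/
theorem finrank_real_ker [FiniteDimensional ℂ V] (hu : ψ u = 1) :
    finrank ℝ ↥(LinearMap.ker (ψ : V →ₗ[ℂ] ℂ)) = 2 * (finrank ℂ V - 1) := by
  rw [finrank_real_of_complex]
  congr 1
  have hsurj : Function.Surjective (ψ : V →ₗ[ℂ] ℂ) := by
    intro c
    refine ⟨c • u, ?_⟩
    change ψ (c • u) = c
    rw [map_smul, hu, smul_eq_mul, mul_one]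
  have h := LinearMap.finrank_range_add_finrank_ker (ψ : V →ₗ[ℂ] ℂ)
  rw [LinearMap.range_eq_top.2 hsurj, finrank_top, Module.finrank_self] at h
  omega

/-- **The punctured hyperplane is a punctured Euclidean space `ℝ²ⁿ⁻² ∖ {0}`**, through a real
linear homeomorphism `ker ψ ≃ ℝᵈ`, `d = 2(n-1)` (`n = finrank_ℂ V`; `d` is a parameter with its
defining equation, to fit the sphere `Sᵈ⁻¹ ⊆ ℝᵈ` of the tree's sphere homology). [folklore] -/
def puncturedKerHomeomorphEuclidean [FiniteDimensional ℂ V] (hu : ψ u = 1) (d : ℕ)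
    (hd : d = 2 * (finrank ℂ V - 1)) :
    ↥(({0}ᶜ : Set ↥(LinearMap.ker (ψ : V →ₗ[ℂ] ℂ)))) ≃ₜ
      ↥(({0}ᶜ : Set (EuclideanSpace ℝ (Fin d)))) :=
  let e : ↥(LinearMap.ker (ψ : V →ₗ[ℂ] ℂ)) ≃L[ℝ] EuclideanSpace ℝ (Fin d) :=
    ContinuousLinearEquiv.ofFinrankEq (by rw [finrank_real_ker hu, finrank_euclideanSpace_fin, hd])
  e.toHomeomorph.subtype fun w ↦ by
    simp only [mem_compl_iff, mem_singleton_iff]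
    exact (e.map_ne_zero_iff (x := w)).symm

end Hyperplane

end Literature.AlgebraicTopology.CharacteristicClasses
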